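/-
Copyright: the b2b-balaban T⁴-continuum CRUX team, row NE7b OWNER lineage `t4-ne7b-p1` (gen 140). Project licence.
-/
import Summits.QuantumFields.BalabanUV.T4Continuum.Spine.NE7b.SupDobrushinCovarianceGibbs
import Summits.QuantumFields.BalabanUV.T4Continuum.Spine.NE7b.SupTruncationCumulantBound

/-!
# DOBRUSHIN'S THIRD-CUMULANT BOUND FOR THE GIBBS LAW `ν ∝ e^{−V}dω` ON `ℝ^ι` (SCOPING (d11)(4), second file): under (447)'s hypotheses
# (coordinate-line `C¹` potential with floor `c > 0`, ceiling, cross letters `J`, `Σ_zJ_{xz}∕c_x ≤ γ < 1`, any `D ≥ 0` with `I + D·C ≤ D`,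
# the moment letters), three observables `F, G, H` of the coordinate-Lipschitz class with vectors `a, b, h` satisfy
#   `|E_ν[(F − E_νF)(G − mG)(H − mH)]| ≤ 2·√(2·(B(a,b) + B(a,h))·m₄)`,    `B(a,b) = Σ_w (Dᵀa)_w(Dᵀb)_w∕c_w`,
# for ANY centrings `mG, mH` whose fourth centred moments (and `F`'s) are `≤ m₄` — by TRUNCATION ((460)): the clamped product
# `T_R(G−mG)·T_R(H−mH)` is in the class with vector `R(b + h)`, so (447) bounds its covariance with `F` by `R·(B(a,b) + B(a,h))`, the tail costs
# `2m₄∕R`, and `R` is optimised.  `B(a,·)` carries the decay of `D` ((453)): the joint cumulant of three local observables decays along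
# the tree at half the two-point rate (row NE7b, node U5c; (441), (446), (447), (460) BY NAME; [folklore])

Cell `pub-balaban`, sub-cell `t4`, spine estimate NE7b (`T4WeightBudget.RelWeightBound`; the cell's OWN estimate — NOT PRINTED in
[Bałaban 1983–89], NOT PROVED).  Crux-route work under `Spine/NE7b/` by the row OWNER (`t4-ne7b-p1` gen 140, file (461)) under FREEZE
(0)'s crux-prover clause; NOTHING of Bałaban's is named as a Lean object, valued or asserted; no `T4Continuum/Support` leaf typed; no
`def`, no notation (the clamp WRITTEN OUT as `max (-R) (min R ·)`); zero `sorry`.  Imports (BY NAME): the OWNER's (447)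
`…SupDobrushinCovarianceGibbs` (`abs_cov_le_kernel_gibbs`, `integral_tilted_eq`; through it (446) `memLp_coord_tilted`, (441) `measurable`,
`integrable`, `lipVec_nonneg`), (460) `…SupTruncationCumulantBound` (`third_centred_le_of_truncated`).

WHAT IS PROVED ([folklore]):
* §1 `clamp_centred_lipVec` (`T_R(G − mG)` has vector `b`), `clamped_prod_lipVec` (the product has vector `R(b + h)`).
* §2 **`truncated_pairing_le`** (`|∫(F − E_νF)·T_R(G−mG)·T_R(H−mH) dν| ≤ R·(B(a,b) + B(a,h))`).
* §3 THE END **`third_cumulant_le`** (`|∫(F − E_νF)(G − mG)(H − mH) dν| ≤ 2√(2(B(a,b)+B(a,h))m₄)`).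
* §4 toy: none (letters in, letter out).

HONEST (what this is NOT).  The fourth centred moments are hypotheses ((423)'s Brascamp–Lieb concentration supplies them in whitened
coordinates: successor file); the DECAY of `B(a_x, b_y)` in the distance of the supports (weighted Neumann (453)) and the double sum
`Σ_{y,z}` of the third-order kernel letter are the successor's; orders four and five are NOT typed.  Scalar skeleton ((A3), NC-NE7b-α
UNRULED); nothing of Bałaban's asserted.  BY-NAME EFFECT ON THE WALL: NONE.  NE7b NOT PRINTED ∕ NOT PROVED; spine PROVED 0∕9; rung (B)+1 —
the programme's measures remain FINITE-torus statements; NOT the mass gap, NOT Clay.  HONEST DEPENDENCY: continuum YM on T⁴ ⇐ BetaPertH ∧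
nine spine estimates (0∕9 proved); BetaPertH ⇐ (D1) ∧ (D4) ∧ CAP+tail; G-an2-4 gates asym, D1 and NE2∕3∕4.
-/

set_option autoImplicit false

noncomputable section

namespace Summit.QuantumFields.BalabanUV.T4Continuum.NE7b.SupDobrushinThirdCumulant

open MeasureTheory Real Set Function Finset
open scoped BigOperators
open SupDobrushinCovarianceGibbs (abs_cov_le_kernel_gibbs integral_tilted_eq)
open SupOneSiteResamplingInvariance (memLp_coord_tilted)
open SupTruncationCumulantBound (third_centred_le_of_truncated)

variable {ι : Type} [Fintype ι] [DecidableEq ι]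

variable {V : (ι → ℝ) → ℝ} {V₁ : ι → (ι → ℝ) → ℝ} {c : ι → ℝ} {Cw γ : ℝ} {J D : ι → ι → ℝ}
  {P : ι → ((ι → ℝ) → ℝ) → ((ι → ℝ) → ℝ)} {F G H : (ι → ℝ) → ℝ} {a b h : ι → ℝ}

/-! ## §1. Clamped observables are in the class -/

omit [Fintype ι] in
/-- **`T_R(G − mG)` has the vector of `G`** (the clamp is `1`-Lipschitz). [folklore] -/
theorem clamp_centred_lipVec (hG : ∀ z ω s t, |G (update ω z s) - G (update ω z t)| ≤ b z * |s - t|) (mG R : ℝ) (z : ι) (ω : ι → ℝ)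
    (s t : ℝ) :
    |max (-R) (min R (G (update ω z s) - mG)) - max (-R) (min R (G (update ω z t) - mG))| ≤ b z * |s - t| := by
  have hL := ((LipschitzWith.id.const_min R).const_max (-R)).dist_le_mul (G (update ω z s) - mG) (G (update ω z t) - mG)
  rw [NNReal.coe_one, one_mul, Real.dist_eq, Real.dist_eq] at hL
  simp only [id] at hL
  refine hL.trans ?_
  have e : G (update ω z s) - mG - (G (update ω z t) - mG) = G (update ω z s) - G (update ω z t) := by ring
  rw [e]
  exact hG z ω s t

omit [Fintype ι] in
/-- **The clamped product `T_R(G − mG)·T_R(H − mH)` is in the class with vector `R(b + h)`**. [folklore] -/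
theorem clamped_prod_lipVec (hG : ∀ z ω s t, |G (update ω z s) - G (update ω z t)| ≤ b z * |s - t|)
    (hH : ∀ z ω s t, |H (update ω z s) - H (update ω z t)| ≤ h z * |s - t|) (mG mH : ℝ) {R : ℝ} (hR : 0 ≤ R) (z : ι) (ω : ι → ℝ) (s t : ℝ) :
    |max (-R) (min R (G (update ω z s) - mG)) * max (-R) (min R (H (update ω z s) - mH)) -
        max (-R) (min R (G (update ω z t) - mG)) * max (-R) (min R (H (update ω z t) - mH))| ≤ (R * (b z + h z)) * |s - t| := by
  set x := max (-R) (min R (G (update ω z s) - mG))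
  set x' := max (-R) (min R (G (update ω z t) - mG))
  set y := max (-R) (min R (H (update ω z s) - mH))
  set y' := max (-R) (min R (H (update ω z t) - mH))
  -- `|T_Ru| ≤ R` (the tree's `Literature.Analysis.FunctionSpaces.abs_max_neg_min_le`, inlined)
  have hTR : ∀ u : ℝ, |max (-R) (min R u)| ≤ R := fun u => abs_le.2 ⟨le_max_left _ _, max_le (by linarith) (min_le_left _ _)⟩
  have e : x * y - x' * y' = x * (y - y') + (x - x') * y' := by ring
  rw [e]
  refine (abs_add_le _ _).trans ?_
  rw [abs_mul, abs_mul]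
  have h1 : |x| * |y - y'| ≤ R * (h z * |s - t|) := mul_le_mul (hTR _) (clamp_centred_lipVec hH mH R z ω s t) (abs_nonneg _) hR
  have h2 : |x - x'| * |y'| ≤ (b z * |s - t|) * R :=
    mul_le_mul (clamp_centred_lipVec hG mG R z ω s t) (hTR _) (abs_nonneg _)
      (mul_nonneg (SupCoordinateLipschitzClass.lipVec_nonneg hG z) (abs_nonneg _))
  calc |x| * |y - y'| + |x - x'| * |y'| ≤ R * (h z * |s - t|) + (b z * |s - t|) * R := add_le_add h1 h2
    _ = (R * (b z + h z)) * |s - t| := by ring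

/-! ## §2. The truncated pairing under the Gibbs law -/

/-- **THE TRUNCATED PAIRING**: `|∫(F − E_νF)·T_R(G−mG)·T_R(H−mH) dν| ≤ R·Σ_w (Dᵀa)_w((Dᵀb)_w + (Dᵀh)_w)∕c_w` — (447) for `F` and the
clamped product. [folklore] -/
theorem truncated_pairing_le
    (hP : ∀ x F ω, P x F ω = (∫ s, F (update ω x s) * exp (-V (update ω x s))) / ∫ s, exp (-V (update ω x s)))
    (hV : ∀ x ω, HasDerivAt (fun s => V (update ω x s)) (V₁ x ω) (ω x))
    (hfloor : ∀ x ω s t, c x * (s - t) ^ 2 ≤ (V₁ x (update ω x s) - V₁ x (update ω x t)) * (s - t)) (hc : ∀ x, 0 < c x)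
    (hceil : ∀ x ω s t, |V₁ x (update ω x s) - V₁ x (update ω x t)| ≤ Cw * |s - t|)
    (hcross : ∀ x z, z ≠ x → ∀ ω s t, |V₁ x (update ω z s) - V₁ x (update ω z t)| ≤ J x z * |s - t|) (hVc : Continuous V)
    (hV0 : Integrable (fun ω : ι → ℝ => exp (-V ω))) (hV2 : ∀ z, Integrable (fun ω : ι → ℝ => ω z ^ 2 * exp (-V ω)))
    (hJ : ∀ x z, 0 ≤ J x z) (hJ0 : ∀ x, J x x = 0) (hrow : ∀ x, ∑ z, J x z / c x ≤ γ) (hγ0 : 0 ≤ γ) (hγ1 : γ < 1)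
    (hD : ∀ x y, 0 ≤ D x y) (hDC : ∀ x y, (if x = y then (1 : ℝ) else 0) + ∑ z, D x z * (J z y / c z) ≤ D x y)
    (hF : ∀ z ω s t, |F (update ω z s) - F (update ω z t)| ≤ a z * |s - t|)
    (hG : ∀ z ω s t, |G (update ω z s) - G (update ω z t)| ≤ b z * |s - t|)
    (hH : ∀ z ω s t, |H (update ω z s) - H (update ω z t)| ≤ h z * |s - t|) (mG mH : ℝ) {R : ℝ} (hR : 0 < R) :
    |∫ ω, (F ω - ∫ ω', F ω' ∂((volume : Measure (ι → ℝ)).tilted fun ω => -V ω)) *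
          (max (-R) (min R (G ω - mG)) * max (-R) (min R (H ω - mH))) ∂((volume : Measure (ι → ℝ)).tilted fun ω => -V ω)| ≤
      R * ∑ w, (∑ z, D z w * a z) * ((∑ z, D z w * b z) + ∑ z, D z w * h z) / c w := by
  set ν : Measure (ι → ℝ) := (volume : Measure (ι → ℝ)).tilted fun ω => -V ω with hν
  haveI : IsProbabilityMeasure ν := isProbabilityMeasure_tilted hV0
  have hμ2 : ∀ z, MemLp (fun ω : ι → ℝ => ω z) 2 ν := memLp_coord_tilted hV0 hV2
  have hK := clamped_prod_lipVec hG hH mG mH hR.le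
  -- `∫(F − mF)K = ∫FK − mF∫K = Cov(F, K)`
  have hIF : Integrable F ν := SupCoordinateLipschitzClass.integrable hF hμ2
  have hIFK : Integrable (fun ω => F ω * (max (-R) (min R (G ω - mG)) * max (-R) (min R (H ω - mH)))) ν :=
    SupCoordinateLipschitzClass.integrable_mul hF hK hμ2
  have hIK : Integrable (fun ω => max (-R) (min R (G ω - mG)) * max (-R) (min R (H ω - mH))) ν :=
    SupCoordinateLipschitzClass.integrable hK hμ2
  have e : ∫ ω, (F ω - ∫ ω', F ω' ∂ν) * (max (-R) (min R (G ω - mG)) * max (-R) (min R (H ω - mH))) ∂ν =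
      ∫ ω, F ω * (max (-R) (min R (G ω - mG)) * max (-R) (min R (H ω - mH))) ∂ν -
        (∫ ω', F ω' ∂ν) * ∫ ω, max (-R) (min R (G ω - mG)) * max (-R) (min R (H ω - mH)) ∂ν := by
    have e1 : ∀ ω, (F ω - ∫ ω', F ω' ∂ν) * (max (-R) (min R (G ω - mG)) * max (-R) (min R (H ω - mH))) =
        F ω * (max (-R) (min R (G ω - mG)) * max (-R) (min R (H ω - mH))) -
          (∫ ω', F ω' ∂ν) * (max (-R) (min R (G ω - mG)) * max (-R) (min R (H ω - mH))) := fun ω => by ring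
    simp_rw [e1]
    rw [integral_sub hIFK (hIK.const_mul _), integral_const_mul]
  rw [e]
  have h447 := abs_cov_le_kernel_gibbs (G := fun ω => max (-R) (min R (G ω - mG)) * max (-R) (min R (H ω - mH)))
    (b := fun z => R * (b z + h z)) hP hV hfloor hc hceil hcross hVc hV0 hV2 hJ hJ0 hrow hγ0 hγ1 hD hDC hF hK
  refine h447.trans (le_of_eq ?_)
  rw [Finset.mul_sum]
  refine Finset.sum_congr rfl fun w _ => ?_
  have e2 : ∑ z, D z w * (R * (b z + h z)) = R * ((∑ z, D z w * b z) + ∑ z, D z w * h z) := by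
    rw [← Finset.sum_add_distrib, Finset.mul_sum]
    exact Finset.sum_congr rfl fun z _ => by ring
  rw [e2]
  ring

/-! ## §3. The third cumulant -/

/-- **DOBRUSHIN'S THIRD-CUMULANT BOUND**: under (447)'s hypotheses and fourth centred moments `≤ m₄`,
`|∫(F − E_νF)(G − mG)(H − mH) dν| ≤ 2√(2·Σ_w (Dᵀa)_w((Dᵀb)_w + (Dᵀh)_w)∕c_w · m₄)`. [folklore] -/
theorem third_cumulant_le
    (hP : ∀ x F ω, P x F ω = (∫ s, F (update ω x s) * exp (-V (update ω x s))) / ∫ s, exp (-V (update ω x s)))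
    (hV : ∀ x ω, HasDerivAt (fun s => V (update ω x s)) (V₁ x ω) (ω x))
    (hfloor : ∀ x ω s t, c x * (s - t) ^ 2 ≤ (V₁ x (update ω x s) - V₁ x (update ω x t)) * (s - t)) (hc : ∀ x, 0 < c x)
    (hceil : ∀ x ω s t, |V₁ x (update ω x s) - V₁ x (update ω x t)| ≤ Cw * |s - t|)
    (hcross : ∀ x z, z ≠ x → ∀ ω s t, |V₁ x (update ω z s) - V₁ x (update ω z t)| ≤ J x z * |s - t|) (hVc : Continuous V)
    (hV0 : Integrable (fun ω : ι → ℝ => exp (-V ω))) (hV2 : ∀ z, Integrable (fun ω : ι → ℝ => ω z ^ 2 * exp (-V ω)))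
    (hJ : ∀ x z, 0 ≤ J x z) (hJ0 : ∀ x, J x x = 0) (hrow : ∀ x, ∑ z, J x z / c x ≤ γ) (hγ0 : 0 ≤ γ) (hγ1 : γ < 1)
    (hD : ∀ x y, 0 ≤ D x y) (hDC : ∀ x y, (if x = y then (1 : ℝ) else 0) + ∑ z, D x z * (J z y / c z) ≤ D x y)
    (hF : ∀ z ω s t, |F (update ω z s) - F (update ω z t)| ≤ a z * |s - t|)
    (hG : ∀ z ω s t, |G (update ω z s) - G (update ω z t)| ≤ b z * |s - t|)
    (hH : ∀ z ω s t, |H (update ω z s) - H (update ω z t)| ≤ h z * |s - t|) (mG mH : ℝ) {m₄ : ℝ}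
    (hF4 : Integrable (fun ω => (F ω - ∫ ω', F ω' ∂((volume : Measure (ι → ℝ)).tilted fun ω => -V ω)) ^ 4)
      ((volume : Measure (ι → ℝ)).tilted fun ω => -V ω))
    (hG4 : Integrable (fun ω => (G ω - mG) ^ 4) ((volume : Measure (ι → ℝ)).tilted fun ω => -V ω))
    (hH4 : Integrable (fun ω => (H ω - mH) ^ 4) ((volume : Measure (ι → ℝ)).tilted fun ω => -V ω))
    (hmF : ∫ ω, (F ω - ∫ ω', F ω' ∂((volume : Measure (ι → ℝ)).tilted fun ω => -V ω)) ^ 4 ∂((volume : Measure (ι → ℝ)).tilted fun ω => -V ω) ≤ m₄)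
    (hmG : ∫ ω, (G ω - mG) ^ 4 ∂((volume : Measure (ι → ℝ)).tilted fun ω => -V ω) ≤ m₄)
    (hmH : ∫ ω, (H ω - mH) ^ 4 ∂((volume : Measure (ι → ℝ)).tilted fun ω => -V ω) ≤ m₄) :
    |∫ ω, (F ω - ∫ ω', F ω' ∂((volume : Measure (ι → ℝ)).tilted fun ω => -V ω)) * (G ω - mG) * (H ω - mH)
        ∂((volume : Measure (ι → ℝ)).tilted fun ω => -V ω)| ≤
      2 * Real.sqrt (2 * (∑ w, (∑ z, D z w * a z) * ((∑ z, D z w * b z) + ∑ z, D z w * h z) / c w) * m₄) := by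
  haveI : IsProbabilityMeasure ((volume : Measure (ι → ℝ)).tilted fun ω => -V ω) := isProbabilityMeasure_tilted hV0
  have ha := SupCoordinateLipschitzClass.lipVec_nonneg hF
  have hb := SupCoordinateLipschitzClass.lipVec_nonneg hG
  have hh := SupCoordinateLipschitzClass.lipVec_nonneg hH
  have hε : 0 ≤ ∑ w, (∑ z, D z w * a z) * ((∑ z, D z w * b z) + ∑ z, D z w * h z) / c w :=
    Finset.sum_nonneg fun w _ => div_nonneg (mul_nonneg (Finset.sum_nonneg fun z _ => mul_nonneg (hD z w) (ha z))
      (add_nonneg (Finset.sum_nonneg fun z _ => mul_nonneg (hD z w) (hb z)) (Finset.sum_nonneg fun z _ => mul_nonneg (hD z w) (hh z)))) (hc w).le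
  have htr := fun R (hR : 0 < R) => truncated_pairing_le hP hV hfloor hc hceil hcross hVc hV0 hV2 hJ hJ0 hrow hγ0 hγ1 hD hDC hF hG hH mG mH hR
  have h := third_centred_le_of_truncated (μ := (volume : Measure (ι → ℝ)).tilted fun ω => -V ω)
    (mF := ∫ ω', F ω' ∂((volume : Measure (ι → ℝ)).tilted fun ω => -V ω)) (mG := mG) (mH := mH)
    (SupCoordinateLipschitzClass.measurable hF) (SupCoordinateLipschitzClass.measurable hG) (SupCoordinateLipschitzClass.measurable hH)
    hε hF4 hG4 hH4 hmF hmG hmH htr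
  exact h

end Summit.QuantumFields.BalabanUV.T4Continuum.NE7b.SupDobrushinThirdCumulant

end
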